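import Summits.HubbardSuperconductivity.HubbardSuperconductivity.Theses.JosephsonMirror
import Summits.HubbardSuperconductivity.HubbardSuperconductivity.Theorems.TwTipContinuation.Negative.TipNormalForm
import Literature.MathematicalPhysics.QuantumLattice.ApproximateEigenvectorLemmas

/-!
# Route `JosephsonMirror` — the glue items

Three bookkeeping items of route `JosephsonMirror` (sub-problem `HubbardSuperconductivity`):

* `JmCruxGlue` (stmt-HubbardSuperconductivity-14297): `JmInterchange → JmCusp → JmPairBridge`.
  `JmCusp` supplies `(U, δ, a, J₀)`, the uniform linear Josephson gain and eventual simplicity of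
  the `(N_L, S^z = 0)` ground floor; `JmInterchange` at the same data supplies `a' > 0`, a
  threshold and, for every large even `L`, a unit ground-floor pair `(φ₀, χ)` with
  `a' L⁴ ≤ |⟨χ, Δ_d φ₀⟩|²`; by simplicity every unit ground state `φ` of `(N_L, 0)` is `c • φ₀`
  with `‖c‖ = 1`, so `|⟨χ, Δ_d φ⟩|² = |⟨χ, Δ_d φ₀⟩|²`.
* `JmTargetToSummit` (stmt-HubbardSuperconductivity-2229): thesis X → summit, by Cauchy–Schwarz
  `‖Δ_d φ‖² ≥ |⟨χ, Δ_d φ⟩|²` for the unit vector `χ` and the even-side `liminf` bookkeeping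
  `summitMatrix_of_everyGSOrder`.
* `Assembly` (stmt-HubbardSuperconductivity-2233): `JmInterchange → JmCusp → HubbardSuperconductivity`,
  the composition of the two.

Sources: D. J. Scalapino, Phys. Rep. 250 (1995) 329, §2 (order functional); C. N. Yang, Rev. Mod.
Phys. 34 (1962) 694 (pair correlations); T. Koma, H. Tasaki, J. Stat. Phys. 76 (1994) 745, §3.4
(tower states). No new definitions.
-/

-- the mandated namespace `Summit.<Summit>.<Problem>.Theorems` repeats `HubbardSuperconductivity`
-- (single-problem summit, D-0017), which the `dupNamespace` linter flags on every declaration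
set_option linter.dupNamespace false

namespace Summit.HubbardSuperconductivity.HubbardSuperconductivity.Theorems.JosephsonMirror

open Matrix Literature.MathematicalPhysics.QuantumLattice
open Summit.HubbardSuperconductivity.HubbardSuperconductivity.Theses.JosephsonMirror
open Summit.HubbardSuperconductivity.TwTipContinuation.Negative (summitMatrix_of_everyGSOrder)

/-- A scalar multiple `c • φ₀` of a unit vector is a unit vector only if `‖c‖ = 1`. [folklore] -/
theorem norm_eq_one_of_smul_unit {n : Type*} [Fintype n] {φ₀ : n → ℂ} {c : ℂ}
    (h₀ : star φ₀ ⬝ᵥ φ₀ = 1) (h : star (c • φ₀) ⬝ᵥ (c • φ₀) = 1) : ‖c‖ = 1 := by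
  simp only [star_smul, smul_dotProduct, dotProduct_smul, h₀, smul_eq_mul, mul_one] at h
  -- `h : c * star c = 1`
  have h2 : (‖c‖ : ℝ) ^ 2 = 1 := by
    have := congrArg Complex.re h
    rw [Complex.star_def, Complex.mul_conj, Complex.ofReal_re, Complex.one_re,
      Complex.normSq_eq_norm_sq] at this
    exact this
  have hn : 0 ≤ ‖c‖ := norm_nonneg c
  nlinarith [h2, hn]

/-- The pair amplitude is insensitive to a phase: `|⟨χ, Δ (c • φ₀)⟩|² = |⟨χ, Δ φ₀⟩|²` when
`‖c‖ = 1`. [folklore] -/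
theorem norm_sq_dotProduct_mulVec_smul_of_norm_eq_one {n : Type*} [Fintype n]
    (Δ : Matrix n n ℂ) (χ φ₀ : n → ℂ) {c : ℂ} (hc : ‖c‖ = 1) :
    ‖star χ ⬝ᵥ Δ *ᵥ (c • φ₀)‖ ^ 2 = ‖star χ ⬝ᵥ Δ *ᵥ φ₀‖ ^ 2 := by
  rw [mulVec_smul, dotProduct_smul, smul_eq_mul, norm_mul, hc, one_mul]

/-- **Cruxes ⇒ thesis X** `JmCruxGlue` (stmt-HubbardSuperconductivity-14297):
`JmInterchange → JmCusp → JmPairBridge`. `JmCusp` gives `(U, δ, a, J₀)`, the uniform linear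
Josephson gain and eventual simplicity (threshold `L₁`); `JmInterchange` at `(U, δ, a, J₀)` gives
`a' > 0`, `L₀` and for every even `L ≥ L₀` a unit ground-floor pair `(φ₀, χ)` with
`a' L⁴ ≤ |⟨χ, Δ_d φ₀⟩|²`; for even `L ≥ max L₀ L₁` every unit ground state `φ` of `(N_L, 0)` is
`c • φ₀` with `‖c‖ = 1`, hence `|⟨χ, Δ_d φ⟩|² = |⟨χ, Δ_d φ₀⟩|² ≥ a' L⁴`: X holds with
`(U, δ, a', max L₀ L₁)`. Koma–Tasaki, J. Stat. Phys. 76 (1994) 745, §3.4. [folklore] -/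
theorem jmCruxGlue_proof :
    Summit.HubbardSuperconductivity.HubbardSuperconductivity.Theses.JosephsonMirror.JmCruxGlue := by
  unfold JmCruxGlue JmInterchange JmCusp JmPairBridge
  rintro hI ⟨U, hU, δ, hδ, a, ha, J₀, hJ₀, hgain, L₁, hsimple⟩
  obtain ⟨a', ha', L₀, hbridge⟩ := hI U δ a J₀ hU hδ ha hJ₀ hgain
  refine ⟨U, hU, δ, hδ, a', ha', max L₀ L₁, fun L _ hE hL φ hφ hφ1 => ?_⟩
  obtain ⟨φ₀, χ, hφ₀, hφ₀1, hχ, hχ1, hle⟩ := hbridge L hE (le_of_max_le_left hL)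
  obtain ⟨c, rfl⟩ := hsimple L hE (le_of_max_le_right hL) φ₀ φ hφ₀ hφ
  refine ⟨χ, hχ, hχ1, ?_⟩
  rwa [norm_sq_dotProduct_mulVec_smul_of_norm_eq_one _ _ _ (norm_eq_one_of_smul_unit hφ₀1 hφ1)]

/-- Cauchy–Schwarz in the form used by the bridge: for a unit vector `χ`,
`|⟨χ, Δ φ⟩|² ≤ Re ⟨φ, Δᴴ Δ φ⟩ = ‖Δ φ‖²`. Yang, Rev. Mod. Phys. 34 (1962) 694, §4. [folklore] -/
theorem norm_sq_dotProduct_mulVec_le_expect {ι : Type*} [LinearOrder ι] [Fintype ι]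
    (Δ : Matrix (Finset ι) (Finset ι) ℂ) {χ : Fock ι} (hχ1 : star χ ⬝ᵥ χ = 1) (φ : Fock ι) :
    ‖star χ ⬝ᵥ Δ *ᵥ φ‖ ^ 2 ≤ (expect (Δᴴ * Δ) φ).re := by
  have hexp : expect (Δᴴ * Δ) φ = star (Δ *ᵥ φ) ⬝ᵥ (Δ *ᵥ φ) := by
    unfold expect
    rw [← mulVec_mulVec, dotProduct_mulVec, star_mulVec]
  rw [hexp, ← eucNorm_sq]
  have h := norm_star_dotProduct_le_eucNorm hχ1 (Δ *ᵥ φ)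
  have h0 : 0 ≤ ‖star χ ⬝ᵥ Δ *ᵥ φ‖ := norm_nonneg _
  exact pow_le_pow_left₀ h0 h 2

/-- **Thesis X ⇒ summit** `JmTargetToSummit` (stmt-HubbardSuperconductivity-2229): the
every-ground-state pair bridge implies the summit. At the bridge's `(U, δ)`, for every even
`L ≥ L₀` and every unit sector ground state `φ` of `(N_L, 0)` the bridge gives a unit `χ` with
`a L⁴ ≤ |⟨χ, Δ_d φ⟩|² ≤ Re ⟨φ, Δ_dᴴ Δ_d φ⟩` (Cauchy–Schwarz), and the even-side `liminf`
bookkeeping `summitMatrix_of_everyGSOrder` (which carries its own a-priori cap keeping Mathlib's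
real `liminf` honest) turns this every-GS order bound into the summit's matrix at `(U, δ)`.
Scalapino, Phys. Rep. 250 (1995) 329, §2 eq. (2.4); Yang, Rev. Mod. Phys. 34 (1962) 694, §4.
[folklore] -/
theorem jmTargetToSummit_proof :
    Summit.HubbardSuperconductivity.HubbardSuperconductivity.Theses.JosephsonMirror.JmTargetToSummit := by
  unfold JmTargetToSummit _root_.HubbardSuperconductivity Literature.Hubbard.DWaveSuperconductivityHubbard
  rintro ⟨U, hU, δ, hδ, a, ha, L₀, hX⟩
  refine ⟨U, hU, δ, hδ, summitMatrix_of_everyGSOrder ⟨a, ha, L₀, ?_⟩⟩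
  intro L _ hL₀ hE ψ hψ1 hgs
  obtain ⟨χ, _, hχ1, hle⟩ := hX L hE hL₀ ψ hgs hψ1
  exact hle.trans (norm_sq_dotProduct_mulVec_le_expect _ hχ1 ψ)

/-- **Assembly of route `JosephsonMirror`** (stmt-HubbardSuperconductivity-2233):
`JmInterchange → JmCusp → HubbardSuperconductivity`, the composition
`jmTargetToSummit_proof (jmCruxGlue_proof hI hC)`. Scalapino, Phys. Rep. 250 (1995) 329, §2.
[folklore] -/
theorem josephsonMirror_assembly_proof :
    Summit.HubbardSuperconductivity.HubbardSuperconductivity.Theses.JosephsonMirror.Assembly := by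
  unfold Assembly
  intro hI hC
  exact jmTargetToSummit_proof (jmCruxGlue_proof hI hC)

end Summit.HubbardSuperconductivity.HubbardSuperconductivity.Theorems.JosephsonMirror
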